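import Mathlib
import Summits.Ventures.PercRepro2.K5Theorem
import Summits.Ventures.PercRepro2.K5TypedK3Marks
import Summits.Ventures.PercRepro2.HCovTyped
import Summits.Ventures.PercRepro2.BernUnique
import Summits.Ventures.PercRepro2.PMK5Inactive
import Summits.Ventures.PercRepro2.PMTypedDict
import Summits.Ventures.PercRepro2.PMPendantDict
import Summits.Ventures.PercRepro2.PMK5Pendant
import Summits.Ventures.PercRepro2.PMTypedPendant

/-!
# ROW 2′TRI ON EVERY `K₅ + PENDANT a₃` INSTANCE: `CovForm.TypedBases ends6 0 1 2 5 4`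
(blind cell PercRepro2, mine-2 g22; the crux's typed form on the first six-vertex family, unconditional)

The typed bases `typedCount F z τ K3 ≥ 0` (types in `{1, 2}` on `F`) on the pendant instance are the
full-profile counts `A(k′, j)` (`PMTypedDict.typedCount_eq_fullCount`), `j` the type of the pendant edge:
* `j = 0` (pinned closed / the `a₃`-isolated base): `A(k′, 0) = 2 (cntPosI − cntNegI)(k′) ≥ 0` — the
  `a₃`-inactive form `Gc_pendant_zero_eq` transferred to `K₅` masses, expanded in the Bernstein basis
  (`Gc_zero_eq_bern_I`) and identified with `Gc_zero_eq_bern` by uniqueness (`A_zero`); the kernel certificate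
  `PMK5Inactive.certI` (the typed BHK 1.4 on `K₅`) gives the sign;
* `j = 3` (pinned open / the glued base): `A(k′, 3) = fullCount (K3 ends5 0 1 2 3 4) k′` (`Gc_pendant_one`,
  the transfer `Gc_transfer`, uniqueness: `A_three`) `≥ 0` by typer-1 g10's `typedBases_K5`;
* `j = 1, 2`: `A(k′, 1) = A(k′, 0) + 2C(k′)`, `A(k′, 2) = 2C(k′) + A(k′, 3)` (`fullCount_pendant_dict`,
  Theorem 15) with `C ≥ 0`.
Hence **`typedBases_K5pendant`**: row 2′TRI holds on every `K₅ + pendant-a₃` instance — for every typed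
edge set, pinning and type map — with NO hypothesis: the (PM) obligation by Theorem 15, the `a₃`-inactive
class by `certI` (where the general typed chain takes `TB14`), the glued base by `typedBases_K5`.
-/

namespace Summit.Ventures.PercRepro2

open CovForm Hub

namespace K5

namespace Pendant

section Tri

variable {R : Type*} [Field R] [LinearOrder R] [IsStrictOrderedRing R]

omit [LinearOrder R] [IsStrictOrderedRing R] in
/-- `tQHo` in the `Q`-first form. -/
lemma tQHo_iff' (ω : Fin 10 → Bool) :
    PM.tQHo ω = true ↔ ω ∈ avoidAll ends5 2 {1} ∩ connEvent ends5 2 0 := by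
  unfold PM.tQHo
  rw [Bool.and_eq_true, tQ_iff, conn_iff_mem ω (by norm_num) (by norm_num)]
  exact Iff.rfl

omit [LinearOrder R] [IsStrictOrderedRing R] in
/-- `tQLo` in the `Q`-first form. -/
lemma tQLo_iff' (ω : Fin 10 → Bool) :
    PM.tQLo ω = true ↔ ω ∈ avoidAll ends5 2 {1} ∩ connEvent ends5 1 0 := by
  unfold PM.tQLo
  rw [Bool.and_eq_true, tQ_iff, conn_iff_mem ω (by norm_num) (by norm_num)]
  exact Iff.rfl

omit [LinearOrder R] [IsStrictOrderedRing R] in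
/-- `tQBLHo` in the `Q`-first form. -/
lemma tQBLHo_iff' (ω : Fin 10 → Bool) :
    PM.tQBLHo ω = true ↔ ω ∈ avoidAll ends5 2 {1} ∩ (connEvent ends5 2 0 ∩ connEvent ends5 1 4) := by
  unfold PM.tQBLHo
  rw [Bool.and_eq_true, Bool.and_eq_true, tQ_iff, conn_iff_mem ω (by norm_num) (by norm_num),
    conn_iff_mem ω (by norm_num) (by norm_num)]
  simp only [Set.mem_inter_iff]; tauto

omit [LinearOrder R] [IsStrictOrderedRing R] in
/-- `tQBLo` in the `Q`-first form. -/
lemma tQBLo_iff' (ω : Fin 10 → Bool) :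
    PM.tQBLo ω = true ↔ ω ∈ avoidAll ends5 2 {1} ∩ (connEvent ends5 1 0 ∩ connEvent ends5 2 4) := by
  unfold PM.tQBLo
  rw [Bool.and_eq_true, Bool.and_eq_true, tQ_iff, conn_iff_mem ω (by norm_num) (by norm_num),
    conn_iff_mem ω (by norm_num) (by norm_num)]
  simp only [Set.mem_inter_iff]; tauto

/-- The signed counts of the `a₃`-inactive certificate. -/
noncomputable def CI (k' : Fin 10 → Fin 4) : R := ((PM.cntPosI k' : ℕ) : R) - ((PM.cntNegI k' : ℕ) : R)

/-- `CI ≥ 0` (the kernel certificate `certI`). -/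
lemma CI_nonneg (k' : Fin 10 → Fin 4) : 0 ≤ (CI k' : R) := by
  unfold CI; rw [sub_nonneg]; exact_mod_cast PM.cntNegI_le_cntPosI k'

/-- **The `a₃`-isolated form on the pendant instance in the Bernstein basis of the `K₅` edges**, with the
inactive certificate's coefficients. -/
theorem Gc_zero_eq_bern_I (p : Fin 11 → R) :
    Gc (Function.update p (Fin.last 10) 0) ends6 0 1 2 5 4 =
      ∑ k' : Fin 10 → Fin 4, bern (p ∘ Fin.castSucc) k' * (2 * CI k') := by
  rw [PMPendant.Gc_pendant_zero_eq (ends := ends6) (a₃ := 5) (u := 3) (f := Fin.last 10)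
    (by rw [ends6_last, Sym2.eq_swap]) leaf_five (by decide) p 0 1 2 4 (by decide) (by decide)]
  simp only [avoidAll6, c14, c20, c24, c10, ← Set.preimage_inter, prob_res, update_comp_castSucc]
  rw [prob_eq_bform _ _ _ tQ_iff, prob_eq_bform _ _ _ tQBL_iff, prob_eq_bform _ _ _ tQHo_iff',
    prob_eq_bform _ _ _ tQBLHo_iff', prob_eq_bform _ _ _ tQB_iff, prob_eq_bform _ _ _ tQLo_iff',
    prob_eq_bform _ _ _ tQBLo_iff']
  have e : ∀ q a b c d e f : R, 2 * q * (a * b - q * c + (d * e - q * f)) =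
      2 * (q * a * b + q * d * e - q * q * f - q * q * c) := by intros; ring
  rw [e, bform_mul_mul, bform_mul_mul, bform_mul_mul, bform_mul_mul, ← Finset.sum_add_distrib,
    ← Finset.sum_sub_distrib, ← Finset.sum_sub_distrib, Finset.mul_sum]
  refine Finset.sum_congr rfl fun k' _ => ?_
  rw [coef3_eq_cnt3, coef3_eq_cnt3, coef3_eq_cnt3, coef3_eq_cnt3]
  unfold CI PM.cntPosI PM.cntNegI
  push_cast
  ring

omit [Field R] [LinearOrder R] [IsStrictOrderedRing R] in
/-- A grid point of the `K₅` edges extends to `Fin 11`. -/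
lemma snoc_comp_castSucc {α : Type*} (q : Fin 10 → α) (c : α) :
    (Fin.snoc (α := fun _ => α) q c) ∘ Fin.castSucc = q := by
  funext e; simp [Fin.snoc_castSucc]

/-- **`A(k′, 0) = 2 CI(k′)`** — the `a₃`-isolated typed bases of the pendant instance are the inactive
certificate's class sums (uniqueness of Bernstein coefficients). -/
theorem A_zero (k' : Fin 10 → Fin 4) :
    (A (Fin.snoc (α := fun _ => Fin 4) k' 0) : R) = 2 * CI k' := by
  have h : (fun k' : Fin 10 → Fin 4 => (A (Fin.snoc (α := fun _ => Fin 4) k' 0) : R)) =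
      fun k' => 2 * CI k' := by
    refine bern_coeff_unique fun i => ?_
    have h1 := Gc_zero_eq_bern (R := R) (Fin.snoc (α := fun _ => R) (fun e => (grid (i e) : R)) 0)
    have h2 := Gc_zero_eq_bern_I (R := R) (Fin.snoc (α := fun _ => R) (fun e => (grid (i e) : R)) 0)
    rw [snoc_comp_castSucc] at h1 h2
    exact h1.symm.trans h2
  exact congrFun h k'

omit [LinearOrder R] [IsStrictOrderedRing R] in
/-- **The transfer of `Gc` at the glued base**: with the pendant edge pinned closed and `u` as the third
mark, `Gc` on `ends6` is `Gc` on `ends5`. -/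
theorem Gc_transfer (p : Fin 11 → R) :
    Gc (Function.update p (Fin.last 10) 0) ends6 0 1 2 3 4 =
      Gc ((Function.update p (Fin.last 10) 0) ∘ Fin.castSucc) ends5 0 1 2 3 4 := by
  unfold Gc DEF EQbo EQb3 EQb3o EQo EQ3 EQ3o PDb PDbo Do gap
  simp only [avoidAll6, TEvent6_123, TEvent6_213, PDEvent6, c10, c20, c14, c24, ← Set.preimage_inter,
    prob_res]

/-- **`A(k′, 3) = fullCount (K3 ends5 0 1 2 3 4) k′`** — the glued typed bases of the pendant instance
are the `K₅` typed bases (uniqueness of Bernstein coefficients). -/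
theorem A_three (k' : Fin 10 → Fin 4) :
    (A (Fin.snoc (α := fun _ => Fin 4) k' 3) : R) = PMTyped.fullCount (K3 ends5 0 1 2 3 4) k' := by
  have h : (fun k' : Fin 10 → Fin 4 => (A (Fin.snoc (α := fun _ => Fin 4) k' 3) : R)) =
      fun k' => PMTyped.fullCount (K3 ends5 0 1 2 3 4) k' := by
    refine bern_coeff_unique fun i => ?_
    have h1 := Gc_one_eq_bern (R := R) (Fin.snoc (α := fun _ => R) (fun e => (grid (i e) : R)) 0)
    have h2 : Gc (Function.update (Fin.snoc (α := fun _ => R) (fun e => (grid (i e) : R)) 0)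
        (Fin.last 10) 1) ends6 0 1 2 5 4 =
        ∑ k', bern (fun e => (grid (i e) : R)) k' * PMTyped.fullCount (K3 ends5 0 1 2 3 4) k' := by
      rw [PMPendant.Gc_pendant_one (ends := ends6) (a₃ := 5) (u := 3) (f := Fin.last 10)
        (by rw [ends6_last, Sym2.eq_swap]) leaf_five (by decide) _ 0 1 2 4 (by decide) (by decide)
        (by decide) (by decide), Gc_transfer, update_comp_castSucc, snoc_comp_castSucc,
        hcov_cubic _ ends5 0 1 2 3 4 (fun _ => 0), PMTyped.triSum_empty_eq_bern]
    rw [snoc_comp_castSucc] at h1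
    exact h1.symm.trans h2
  exact congrFun h k'

/-- A full profile on `K₅` as a pinned typed count of `typedBases_K5`: the typed edges are those of type
`1` or `2`, the others pinned by the type. -/
theorem fullCount_K5_nonneg (k' : Fin 10 → Fin 4) :
    0 ≤ (PMTyped.fullCount (K3 ends5 0 1 2 3 4) k' : R) := by
  set F : Finset (Fin 10) := Finset.univ.filter (fun e => k' e = 1 ∨ k' e = 2) with hF
  set z : Config (Fin 10) := fun e => decide (k' e = 3) with hz
  set τ : Fin 10 → ℕ := fun e => (k' e : ℕ) with hτ
  have hτ' : ∀ e ∈ F, τ e = 1 ∨ τ e = 2 := fun e he => by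
    rw [hF, Finset.mem_filter] at he
    rcases he.2 with h | h <;> simp [hτ, h]
  have h3 : ∀ e ∈ F, τ e ≤ 3 := fun e _ => by simp only [hτ]; omega
  have hk : PMTyped.fullProfile F z τ h3 = k' := by
    funext e
    unfold PMTyped.fullProfile
    by_cases he : e ∈ F
    · rw [dif_pos he]
    · rw [dif_neg he]
      rw [hF, Finset.mem_filter, not_and, not_or] at he
      have h := he (Finset.mem_univ e)
      have hv : k' e = 0 ∨ k' e = 3 := by
        generalize k' e = v at h
        fin_cases v <;> simp_all
      rcases hv with hv | hv <;> simp [hz, hv]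
  have := typedBases_K5 (R := R) F z τ hτ'
  rw [PMTyped.typedCount_eq_fullCount F z τ h3, hk] at this
  exact this

/-- **ROW 2′TRI ON EVERY `K₅ + PENDANT a₃` INSTANCE**: `CovForm.TypedBases ends6 0 1 2 5 4` — every typed
three-copy count of `K3` on the pendant instance (marks `(o, a₁, a₂, a₃, b) = (0, 1, 2, 5, 4)`, the leaf
`a₃ = 5` at `u = 3`) with types in `{1, 2}` on the typed edges is nonnegative, for every typed edge set and
pinning. -/
theorem typedBases_K5pendant : CovForm.TypedBases (R := R) ends6 0 1 2 5 4 := by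
  intro F z τ hτ
  have h' : ∀ e ∈ F, τ e ≤ 3 := fun e he => by rcases hτ e he with h | h <;> omega
  rw [PMTyped.typedCount_eq_fullCount F z τ h']
  show 0 ≤ (A (PMTyped.fullProfile F z τ h') : R)
  set k := PMTyped.fullProfile F z τ h' with hk
  rw [← Fin.snoc_init_self k]
  have hd := congrFun (fullCount_pendant_dict (R := R))
  generalize hj : k (Fin.last 10) = j
  have hC := C_nonneg (R := R) (Fin.init k)
  have h0 : 0 ≤ (A (Fin.snoc (α := fun _ => Fin 4) (Fin.init k) 0) : R) := by
    rw [A_zero]; linarith [CI_nonneg (R := R) (Fin.init k)]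
  have h3 : 0 ≤ (A (Fin.snoc (α := fun _ => Fin 4) (Fin.init k) 3) : R) := by
    rw [A_three]; exact fullCount_K5_nonneg _
  fin_cases j
  · exact h0
  · rw [hd, B_snoc]; simp; linarith
  · rw [hd, B_snoc]; simp; linarith
  · exact h3

end Tri

end Pendant

end K5

end Summit.Ventures.PercRepro2
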